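import Mathlib

/-!
# BallLines — negative lines of a hermitian form of signature (2,1) and the complex 2-ball

route/T4-B2-p4.md, B2.5(b): the conjugacy class `X` of Liu's Hodge map `h_{V(ϑ₁),τ₁}` is the set of
NEGATIVE LINES of `W₁ = V(ϑ₁) ⊗_{F,τ₁} ℂ ≅ ℂ³` for the form `|x₀|² + |x₁|² − |x₂|²` (Liu p. 107
ll. 50–56: `U(V) ⊗_{F,τ} ℝ` preserves `diag(I_{p_τ}, −I_{q_τ})`; Gross §10: «h … associated to a
negative one dimensional subspace»), and a negative line has a unique spanning vector of the form
`(z₁, z₂, 1)` with `|z₁|² + |z₂|² < 1`. This file kernel-checks that point-set identification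
`X ≅ 𝔹²` (the «complex 2-ball» of the brief):

* `hermForm21` — the form `‖v 0‖² + ‖v 1‖² − ‖v 2‖²` on `Fin 3 → ℂ`; `hermForm21_smul`;
* `coord_two_ne_zero_of_neg` — a negative vector has `v 2 ≠ 0` (the form is positive definite on
  `x₂ = 0`);
* `normalize`, `normalize_mem_ball` — the point `(v 0 / v 2, v 1 / v 2)` of the open unit ball
  `ball₂ ⊂ ℂ²`;
* `homog`, `hermForm21_homog_neg_iff` — `(z₁, z₂, 1)` is negative iff `(z₁, z₂) ∈ ball₂`;
* `exists_unique_ball_point` — every negative vector is `v 2 • homog z` for a UNIQUE `z ∈ ball₂`,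
  and `span_eq_iff` — two negative vectors span the same line iff they give the same `z`.

The group-theoretic half of B2.5(b) (transitivity of `U(2,1)` on negative lines, the stabiliser
`U(2) × U(1)`, Moonen 1.5) stays in the prose.
-/

namespace Summit.Ventures.HodgeRepro2.BallLines

open Complex

/-- The hermitian form of signature `(2,1)` on `ℂ³` in the basis of Liu p. 107 l. 55
(`diag(I_2, −I_1)`), evaluated on the diagonal: `‖v 0‖² + ‖v 1‖² − ‖v 2‖²`. -/
noncomputable def hermForm21 (v : Fin 3 → ℂ) : ℝ := ‖v 0‖ ^ 2 + ‖v 1‖ ^ 2 - ‖v 2‖ ^ 2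

/-- The open unit ball `𝔹² = {(z₁, z₂) : |z₁|² + |z₂|² < 1}` in `ℂ²`. -/
def ball₂ : Set (ℂ × ℂ) := {z | ‖z.1‖ ^ 2 + ‖z.2‖ ^ 2 < 1}

/-- Homogeneous coordinates `(z₁, z₂, 1)` of a point of `ℂ²`. -/
def homog (z : ℂ × ℂ) : Fin 3 → ℂ := ![z.1, z.2, 1]

/-- The point of `ℂ²` with homogeneous coordinates `v`: `(v 0 / v 2, v 1 / v 2)`. -/
noncomputable def normalize (v : Fin 3 → ℂ) : ℂ × ℂ := (v 0 / v 2, v 1 / v 2)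

/-- First homogeneous coordinate. -/
@[simp] theorem homog_zero (z : ℂ × ℂ) : homog z 0 = z.1 := rfl

/-- Second homogeneous coordinate. -/
@[simp] theorem homog_one (z : ℂ × ℂ) : homog z 1 = z.2 := rfl

/-- Third homogeneous coordinate (the normalisation `1`). -/
@[simp] theorem homog_two (z : ℂ × ℂ) : homog z 2 = 1 := rfl

/-- Homogeneity: `hermForm21 (c • v) = ‖c‖² · hermForm21 v`. -/
theorem hermForm21_smul (c : ℂ) (v : Fin 3 → ℂ) :
    hermForm21 (c • v) = ‖c‖ ^ 2 * hermForm21 v := by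
  simp only [hermForm21, Pi.smul_apply, smul_eq_mul, norm_mul, mul_pow]
  ring

/-- `hermForm21 (homog z) = ‖z₁‖² + ‖z₂‖² − 1`. -/
theorem hermForm21_homog (z : ℂ × ℂ) : hermForm21 (homog z) = ‖z.1‖ ^ 2 + ‖z.2‖ ^ 2 - 1 := by
  simp [hermForm21, homog]

/-- `(z₁, z₂, 1)` is a negative vector iff `(z₁, z₂)` lies in the open unit ball. -/
theorem hermForm21_homog_neg_iff (z : ℂ × ℂ) : hermForm21 (homog z) < 0 ↔ z ∈ ball₂ := by
  rw [hermForm21_homog]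
  simp only [ball₂, Set.mem_setOf_eq]
  constructor <;> intro h <;> linarith

/-- A negative vector has non-zero last coordinate: on `x₂ = 0` the form is positive definite. -/
theorem coord_two_ne_zero_of_neg (v : Fin 3 → ℂ) (h : hermForm21 v < 0) : v 2 ≠ 0 := by
  intro h2
  simp only [hermForm21, h2, norm_zero] at h
  have h0 : (0 : ℝ) ≤ ‖v 0‖ ^ 2 := sq_nonneg _
  have h1 : (0 : ℝ) ≤ ‖v 1‖ ^ 2 := sq_nonneg _
  linarith

/-- A negative vector is `v 2 • homog (normalize v)`. -/
theorem eq_smul_homog_normalize (v : Fin 3 → ℂ) (h : hermForm21 v < 0) :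
    v = v 2 • homog (normalize v) := by
  have h2 : v 2 ≠ 0 := coord_two_ne_zero_of_neg v h
  ext i
  fin_cases i <;> simp [homog, normalize] <;> field_simp

/-- The normalised point of a negative vector lies in the ball. -/
theorem normalize_mem_ball (v : Fin 3 → ℂ) (h : hermForm21 v < 0) : normalize v ∈ ball₂ := by
  have h2 : v 2 ≠ 0 := coord_two_ne_zero_of_neg v h
  rw [← hermForm21_homog_neg_iff]
  have hv : hermForm21 v = ‖v 2‖ ^ 2 * hermForm21 (homog (normalize v)) := by
    conv_lhs => rw [eq_smul_homog_normalize v h]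
    exact hermForm21_smul _ _
  have hpos : 0 < ‖v 2‖ ^ 2 := by positivity
  rw [hv] at h
  exact neg_of_mul_neg_right h hpos.le

/-- `normalize (c • v) = normalize v` for `c ≠ 0`. -/
theorem normalize_smul (c : ℂ) (hc : c ≠ 0) (v : Fin 3 → ℂ) :
    normalize (c • v) = normalize v := by
  simp only [normalize, Pi.smul_apply, smul_eq_mul]
  rw [mul_div_mul_left _ _ hc, mul_div_mul_left _ _ hc]

/-- `normalize (homog z) = z`. -/
theorem normalize_homog (z : ℂ × ℂ) : normalize (homog z) = z := by
  simp [normalize, homog]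

/-- B2.5(b), point-set form: every negative vector `v` is `v 2 • homog z` for a UNIQUE `z`, and
that `z` lies in the open unit ball. -/
theorem exists_unique_ball_point (v : Fin 3 → ℂ) (h : hermForm21 v < 0) :
    ∃! z : ℂ × ℂ, z ∈ ball₂ ∧ v = v 2 • homog z := by
  refine ⟨normalize v, ⟨normalize_mem_ball v h, eq_smul_homog_normalize v h⟩, ?_⟩
  rintro z ⟨-, hz⟩
  have h2 : v 2 ≠ 0 := coord_two_ne_zero_of_neg v h
  have : normalize v = normalize (v 2 • homog z) := by rw [← hz]
  rw [normalize_smul _ h2 _, normalize_homog] at this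
  exact this.symm

/-- Two negative vectors are proportional (span the same line) iff they have the same
normalised point: the map «negative line ↦ point of `𝔹²`» is well defined and injective. -/
theorem span_eq_iff (v w : Fin 3 → ℂ) (hv : hermForm21 v < 0) (hw : hermForm21 w < 0) :
    (∃ c : ℂ, c ≠ 0 ∧ w = c • v) ↔ normalize w = normalize v := by
  have hv2 : v 2 ≠ 0 := coord_two_ne_zero_of_neg v hv
  have hw2 : w 2 ≠ 0 := coord_two_ne_zero_of_neg w hw
  constructor
  · rintro ⟨c, hc, rfl⟩
    exact normalize_smul c hc v
  · intro hn
    refine ⟨w 2 / v 2, div_ne_zero hw2 hv2, ?_⟩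
    calc w = w 2 • homog (normalize w) := eq_smul_homog_normalize w hw
      _ = w 2 • homog (normalize v) := by rw [hn]
      _ = (w 2 / v 2) • (v 2 • homog (normalize v)) := by rw [smul_smul, div_mul_cancel₀ _ hv2]
      _ = (w 2 / v 2) • v := by rw [← eq_smul_homog_normalize v hv]

/-- Surjectivity onto the ball: every `z ∈ 𝔹²` is the normalised point of the negative vector
`homog z`. -/
theorem surjective_normalize (z : ℂ × ℂ) (hz : z ∈ ball₂) :
    ∃ v : Fin 3 → ℂ, hermForm21 v < 0 ∧ normalize v = z :=
  ⟨homog z, (hermForm21_homog_neg_iff z).2 hz, normalize_homog z⟩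

end Summit.Ventures.HodgeRepro2.BallLines
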